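import Literature.Probability.Percolation.ArmSeparationSlotMove
import Literature.Probability.Percolation.ArmSeparationSlotProb
import Literature.Probability.Percolation.LocallyMonotoneFKG
import HarnessLib

/-!
# The landing inequality of the internal extremities (Nolin's `C₁`)

Topic: Probability / Percolation; family `crit-perc`. A brick of the discharge of
`Literature.Probability.Percolation.Nolin2008_twoArm_separation` (Nolin 2008, Thm. 11
[arXiv 0711.4948: Thm. 10], `j = 2`, `σ = BW`; `ArmSeparation.lean`), landing step of the internal
extremities (Nolin 2008, Prop. 12 (iii) then (i) [arXiv Prop. 11], §4.4: "there exist universal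
constants `C₁(η')` … such that we can choose some `I_{η'}` … `P(Ã^{·/η'}) ≤ C₁(η') P(Ã̃^{·/η',I_{η'}})`").
Per slot, Nolin's Lemma 13 [arXiv Lemma 12] (`triSitePercolation_locallyMonotone_fkg`, PROVED in the
tree) applied to `A⁺ = blackArm σ`, `A⁻ = whiteArm σ`, `Ã⁺ = blackCorr σ`, `Ã⁻ = whiteCorr σ` with the
supports of `ArmSeparationSlotEvents.lean` (disjoint by `ArmSeparationSlotSep.lean` as soon as the
slot holds both arms), and the landing `A⁺ ∩ A⁻ ∩ Ã⁺ ∩ Ã⁻ ⊆ sepTwoArm n N`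
(`ArmSeparationSlotMove.lean`), give `P(A⁺ ∩ A⁻) ≤ P(sepTwoArm n N) / (P(Ã⁺) P(Ã⁻))`
(`Slot.real_inter_le`); summing over the finitely many slots (`slotFinset`, covering
`IntTinyExt`) gives the landing inequality `real_intTinyExt_le`:
`P(IntTinyExt m N k₀ K R₀) ≤ #slots · P(sepTwoArm n N) / c²`, with `c` the corridor bound of
`real_corrEvent_ge`.

## References

* P. Nolin, *Near-critical percolation in two dimensions*, Electron. J. Probab. 13 (2008), §4.3
  Prop. 12, Lemma 13, §4.4 [arXiv 0711.4948: Prop. 11, Lemma 12, Thm. 10]. [Nolin2008]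
* H. Kesten, *Scaling relations for 2D-percolation*, Comm. Math. Phys. 109 (1987), Lemma 2, §2. [Kesten1987]
-/

noncomputable section

open Set MeasureTheory

namespace Literature.Probability.Percolation

open LatticeModels HalfAnnulus Tube

namespace Slot

variable {P : LParams} {σ : Slot}

/-- The framed slot box of the open tip lies in the private support `Pfin`. [folklore] -/
theorem image_slotFrame_subset_Pfin (P : LParams) (σ : Slot) :
    frameIso σ.io '' (↑(slotFrame P.m (σ.ko P) (σ.To P) P.w) : Set (Site 2)) ⊆ ↑(σ.Pfin P) := by
  rintro v ⟨u, hu, rfl⟩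
  rw [Pfin, coe_corrFin]
  exact Or.inl (Or.inl ⟨u, Or.inl hu, rfl⟩)

/-- The framed slot box of the closed tip lies in the private support `Mfin` (`ic < 6`). [folklore] -/
theorem image_slotFrame_subset_Mfin (P : LParams) (σ : Slot) (hic : σ.ic < 6) :
    frameIso σ.ic '' (↑(slotFrame P.m (σ.kc P) (σ.Tc P) P.w) : Set (Site 2)) ⊆ ↑(σ.Mfin P) := by
  rintro v ⟨u, hu, rfl⟩
  rw [Mfin, Finset.coe_image]
  refine ⟨-(frameIso σ.ic u), ?_, neg_neg _⟩
  rw [coe_corrFin]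
  refine Or.inl (Or.inl ⟨u, Or.inl hu, ?_⟩)
  have := frameIso_add_three hic u
  rw [show (σ.ic + 3) % 6 = σ.ic' from rfl] at this
  exact this

/-- **The per-slot landing inequality** (Nolin's Prop. 12 for one position of the two tips):
`P(blackArm ∩ whiteArm) · (P(blackCorr) · P(whiteCorr)) ≤ P(sepTwoArm n N)`. [cite: Nolin2008, §4.3 Prop. 12 and Lemma 13 (arXiv 0711.4948: Prop. 11, Lemma 12)] -/
theorem real_inter_mul_le (hV : P.Valid) (hK : 1 ≤ P.K) (hσ : σ.InRange P) :
    (triSitePercolation half).real (σ.blackArm P ∩ σ.whiteArm P) *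
        ((triSitePercolation half).real (σ.blackCorr P) * (triSitePercolation half).real (σ.whiteCorr P)) ≤
      (triSitePercolation half).real (sepTwoArm P.n P.N) := by
  obtain ⟨hs, hw, he, hε, hk₀, hkμ, hrB, hrB', hrW, hrW', hnB, hnW, hm, hN, hn, hμn, hR₀, hR₀n⟩ := hV.facts
  by_cases hne : (σ.blackArm P ∩ σ.whiteArm P).Nonempty
  · obtain ⟨ω, hω⟩ := hne
    have hadm := admissible_of_mem hω
    have hKm : ∀ j < P.K, 64 * trapScale P.k₀ j < P.m := fun j hj => by
      have := P.scale_le hj; clear * - this hμn hm; omega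
    have hsep := sepOK_of_mem hN hKm hσ.hio hω
    obtain ⟨hSP, hSM⟩ := disjoint_shared hV hσ hadm (P.N + P.N / 8)
    have hPM := disjoint_Pfin_Mfin hV hK hσ hadm hsep
    have hk2 : 2 ≤ P.k₀ := by clear * - hk₀; omega
    have hk1 : 1 ≤ P.k₀ := by clear * - hk₀; omega
    have key := triSitePercolation_locallyMonotone_fkg half hSP hSM hPM (σ.isUpperSet_blackArm P) (σ.isLowerSet_whiteArm P)
      (σ.isUpperSet_blackCorr P) (σ.isLowerSet_whiteCorr P)
      ((σ.determinedBy_blackArm P hN le_rfl hσ.hio hk1).mono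
        (Set.union_subset_union_right _ (image_slotFrame_subset_Pfin P σ)))
      ((σ.determinedBy_whiteArm P hN le_rfl hσ.hic hk1).mono
        (Set.union_subset_union_right _ (image_slotFrame_subset_Mfin P σ hσ.hic)))
      (σ.determinedBy_blackCorr P hk2) (σ.determinedBy_whiteCorr P hk2)
    exact key.trans (measureReal_mono (inter_subset_sepTwoArm hV hK hσ hadm hsep) (measure_ne_top _ _))
  · rw [Set.not_nonempty_iff_eq_empty] at hne
    rw [hne, measureReal_empty, zero_mul]
    exact measureReal_nonneg

end Slot

/-! ### The sum over the slots -/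

deriving instance DecidableEq for Slot

/-- **The finite set of slots** (`io, ic < 6`, `jo, jc < K`, `no, nc < Nw`). [cite: Nolin2008, §4.4 (arXiv 0711.4948: Thm. 10, internal extremities)] -/
def slotFinset (P : LParams) : Finset Slot :=
  ((Finset.range 6 ×ˢ Finset.range P.K ×ˢ Finset.range P.Nw) ×ˢ (Finset.range 6 ×ˢ Finset.range P.K ×ˢ Finset.range P.Nw)).image
    fun x => ⟨x.1.1, x.1.2.1, x.1.2.2, x.2.1, x.2.2.1, x.2.2.2⟩

/-- Membership in the finite set of slots. [folklore] -/
theorem mem_slotFinset {P : LParams} {σ : Slot} :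
    σ ∈ slotFinset P ↔ σ.io < 6 ∧ σ.jo < P.K ∧ σ.no < P.Nw ∧ σ.ic < 6 ∧ σ.jc < P.K ∧ σ.nc < P.Nw := by
  unfold slotFinset
  rw [Finset.mem_image]
  constructor
  · rintro ⟨x, hx, rfl⟩
    simp only [Finset.mem_product, Finset.mem_range] at hx
    exact ⟨hx.1.1, hx.1.2.1, hx.1.2.2, hx.2.1, hx.2.2.1, hx.2.2.2⟩
  · rintro ⟨h1, h2, h3, h4, h5, h6⟩
    refine ⟨((σ.io, σ.jo, σ.no), (σ.ic, σ.jc, σ.nc)), ?_, ?_⟩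
    · simp only [Finset.mem_product, Finset.mem_range]
      exact ⟨⟨h1, h2, h3⟩, h4, h5, h6⟩
    · cases σ; rfl

/-- The number of slots is at most `(6 K Nw)²`. [folklore] -/
theorem card_slotFinset_le (P : LParams) : (slotFinset P).card ≤ (6 * P.K * P.Nw) ^ 2 := by
  unfold slotFinset
  refine Finset.card_image_le.trans ?_
  simp only [Finset.card_product, Finset.card_range]
  nlinarith

/-- **The slots cover the tiny-fenced two-arm event** (finite-set form; `1 ≤ w`, `1 ≤ R₀`). [cite: Nolin2008, §4.4 (arXiv 0711.4948: Thm. 10, internal extremities)] -/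
theorem intTinyExt_subset_biUnion_slotFinset (P : LParams) (hw : 1 ≤ P.w) (hR : 1 ≤ P.R₀) :
    IntTinyExt P.m P.N P.k₀ P.K P.R₀ ⊆ ⋃ σ ∈ slotFinset P, Slot.blackArm P σ ∩ Slot.whiteArm P σ := by
  intro ω hω
  have h := intTinyExt_subset_iUnion_slot P hw hR hω
  simp only [Set.mem_iUnion, Set.mem_setOf_eq, exists_prop] at h ⊢
  obtain ⟨σ, hσ, hmem⟩ := h
  exact ⟨σ, mem_slotFinset.2 hσ, hmem⟩

/-- **The landing inequality of the internal extremities**: for a valid rung and constants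
`cB, cW > 0` bounding the corridor probabilities of every slot from below,
`P(IntTinyExt m N k₀ K R₀) ≤ (6 K Nw)² · P(sepTwoArm n N) / (cB cW)`. [cite: Nolin2008, §4.4, proof of Thm. 11, internal extremities: Prop. 12 (iii) then (i) (arXiv 0711.4948: Thm. 10, Prop. 11)] -/
theorem real_intTinyExt_le {P : LParams} (hV : P.Valid) (hK : 1 ≤ P.K) {cB cW : ℝ} (hcB : 0 < cB) (hcW : 0 < cW)
    (hB : ∀ σ ∈ slotFinset P, cB ≤ (triSitePercolation half).real (Slot.blackCorr P σ))
    (hW : ∀ σ ∈ slotFinset P, cW ≤ (triSitePercolation half).real (Slot.whiteCorr P σ)) :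
    (triSitePercolation half).real (IntTinyExt P.m P.N P.k₀ P.K P.R₀) ≤
      ((6 * P.K * P.Nw) ^ 2 : ℕ) * ((triSitePercolation half).real (sepTwoArm P.n P.N) / (cB * cW)) := by
  obtain ⟨hs, hw, he, hε, hk₀, hkμ, hrB, hrB', hrW, hrW', hnB, hnW, hm, hN, hn, hμn, hR₀, hR₀n⟩ := hV.facts
  have hw1 : 1 ≤ P.w := by rw [hw]; clear * - hk₀; omega
  have hR1 : 1 ≤ P.R₀ := by clear * - hR₀ hkμ hk₀; omega
  have hslot : ∀ σ ∈ slotFinset P, (triSitePercolation half).real (Slot.blackArm P σ ∩ Slot.whiteArm P σ) ≤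
      (triSitePercolation half).real (sepTwoArm P.n P.N) / (cB * cW) := by
    intro σ hσ
    obtain ⟨h1, h2, h3, h4, h5, h6⟩ := mem_slotFinset.1 hσ
    have hr : Slot.InRange P σ := ⟨h1, h2, h4, h5⟩
    have key := Slot.real_inter_mul_le hV hK hr
    rw [le_div_iff₀ (mul_pos hcB hcW)]
    refine le_trans ?_ key
    have hnn : 0 ≤ (triSitePercolation half).real (Slot.blackArm P σ ∩ Slot.whiteArm P σ) := measureReal_nonneg
    exact mul_le_mul_of_nonneg_left (mul_le_mul (hB σ hσ) (hW σ hσ) hcW.le measureReal_nonneg) hnn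
  calc (triSitePercolation half).real (IntTinyExt P.m P.N P.k₀ P.K P.R₀)
      ≤ (triSitePercolation half).real (⋃ σ ∈ slotFinset P, Slot.blackArm P σ ∩ Slot.whiteArm P σ) :=
        measureReal_mono (intTinyExt_subset_biUnion_slotFinset P hw1 hR1) (measure_ne_top _ _)
    _ ≤ ∑ σ ∈ slotFinset P, (triSitePercolation half).real (Slot.blackArm P σ ∩ Slot.whiteArm P σ) :=
        measureReal_biUnion_finset_le _ _
    _ ≤ ∑ _σ ∈ slotFinset P, (triSitePercolation half).real (sepTwoArm P.n P.N) / (cB * cW) := Finset.sum_le_sum hslot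
    _ = (slotFinset P).card * ((triSitePercolation half).real (sepTwoArm P.n P.N) / (cB * cW)) := by
        rw [Finset.sum_const, nsmul_eq_mul]
    _ ≤ ((6 * P.K * P.Nw) ^ 2 : ℕ) * ((triSitePercolation half).real (sepTwoArm P.n P.N) / (cB * cW)) :=
        mul_le_mul_of_nonneg_right (by exact_mod_cast card_slotFinset_le P)
          (div_nonneg measureReal_nonneg (mul_pos hcB hcW).le)

end Literature.Probability.Percolation
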